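import Summits.Ventures.PercRepro.HyperplaneKeyBases

/-!
# PercRepro — THE HYPERPLANE KEY AT LEVEL `6`, SHARPENED: THE ROWS `9 … 21` FROM `n ≥ 102 … 120` (p1, gen 43; S3 feeder —
p8 owns SUBCLAIM-S3; no window claim here)

The flat-by-flat count of `HyperplaneKeyBases` with the `e`-free flat bounds `f(0 … 6) = 0, 1, 3, 6, 10, 19, 39`
(`flat_six_of_free`) gives the weights `g = 1, 2, 4, 8, 32, 99, 387624` (`flat_six_weights`: `j!·2^s ≤ g_j·∏_{i<j} max(s − f_i, 1)`
for every `j ≤ s ≤ f_j`, a finite check) in place of `2^{f_j − j} = 1, 1, 2, 8, 64, 2^14, 2^33`, so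
`#{ρ ≤ 6} ≤ 1 + 2n + 4·C(n,2) + 8·C(n,3) + 32·C(n,4) + 99·C(n,5) + 387624·C(n,6)` (`ncard_eRk_le_six_le_of_free_flats`) and
**`RLS M p 6` for every `e`-free `M` of rank `p` on `n ≥ n₀(p)` points, `n₀ = 102 / 104 / 106 / 106 / 108 / 110 / 110 / 112 /
114 / 114 / 116 / 118 / 120` at `p = 9 … 21`** (the cells `(p, d)` with `d ≥ 93 … 99`; before: `136 … 152`, `d ≥ 127 … 131`).
Coloops are not excluded. Nothing is claimed about any cell below these coranks.

* `flat_six_weights` — the finite check (the weights `g` and the bounds `f` are written out as functions); `ncard_eRk_le_six_le_of_free_flats` — the count;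
  `c025_core_six_hyperplane_key_sharp_<p>` — the rows.
Axioms: standard.
-/

open scoped Matroid

namespace PercRepro

namespace HypKey

open Set

variable {α : Type}

/-- `flat_six_of_free` with the bounds as one function `f = 0, 1, 3, 6, 10, 19, 39`. -/
theorem flat_six_of_free' (M : Matroid α) [M.Finite]
    (hfree : ∀ e ∈ M.E, ∃ A ⊆ M.E \ {e}, e ∉ M.closure A ∧ e ∉ M.closure ((M.E \ {e}) \ A)) :
    ∀ j : ℕ, j ≤ 6 → ∀ X ⊆ M.E, M.eRk X ≤ (j : ℕ∞) → X.ncard ≤ (fun j : ℕ => if j ≤ 2 then 2 ^ j - 1 else if j = 3 then 6 else if j = 4 then 10 else if j = 5 then 19 else 39) j :=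
  flat_six_of_free M hfree

set_option maxHeartbeats 1600000 in
/-- The finite check at `j = 6`: `720·2^s ≤ 387624·∏_{i<6} max(s − f_i, 1)` for `6 ≤ s ≤ 39` (the ratio peaks at `s = 39`:
`720·2^39 / (39·38·36·33·29·20) = 387623.13…`). -/
theorem flat_six_weights_six : ∀ s, 6 ≤ s → s ≤ 39 →
    Nat.factorial 6 * 2 ^ s ≤ (fun j : ℕ => if j = 0 then 1 else if j = 1 then 2 else if j = 2 then 4 else if j = 3 then 8 else if j = 4 then 32 else if j = 5 then 99 else 387624) 6 * ∏ i ∈ Finset.range 6, max (s - (fun j : ℕ => if j ≤ 2 then 2 ^ j - 1 else if j = 3 then 6 else if j = 4 then 10 else if j = 5 then 19 else 39) i) 1 := by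
  intro s h1 h2
  interval_cases s <;> decide

set_option maxHeartbeats 1600000 in
/-- The finite check at `j = 5`: `120·2^s ≤ 99·∏_{i<5} max(s − f_i, 1)` for `5 ≤ s ≤ 19`. -/
theorem flat_six_weights_five : ∀ s, 5 ≤ s → s ≤ 19 →
    Nat.factorial 5 * 2 ^ s ≤ (fun j : ℕ => if j = 0 then 1 else if j = 1 then 2 else if j = 2 then 4 else if j = 3 then 8 else if j = 4 then 32 else if j = 5 then 99 else 387624) 5 * ∏ i ∈ Finset.range 5, max (s - (fun j : ℕ => if j ≤ 2 then 2 ^ j - 1 else if j = 3 then 6 else if j = 4 then 10 else if j = 5 then 19 else 39) i) 1 := by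
  intro s h1 h2
  interval_cases s <;> decide

/-- The finite check at `j = 4`: `24·2^s ≤ 32·∏_{i<4} max(s − f_i, 1)` for `4 ≤ s ≤ 10`. -/
theorem flat_six_weights_four : ∀ s, 4 ≤ s → s ≤ 10 →
    Nat.factorial 4 * 2 ^ s ≤ (fun j : ℕ => if j = 0 then 1 else if j = 1 then 2 else if j = 2 then 4 else if j = 3 then 8 else if j = 4 then 32 else if j = 5 then 99 else 387624) 4 * ∏ i ∈ Finset.range 4, max (s - (fun j : ℕ => if j ≤ 2 then 2 ^ j - 1 else if j = 3 then 6 else if j = 4 then 10 else if j = 5 then 19 else 39) i) 1 := by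
  intro s h1 h2
  interval_cases s <;> decide

/-- The finite check at `j = 3`: `6·2^s ≤ 8·∏_{i<3} max(s − f_i, 1)` for `3 ≤ s ≤ 6`. -/
theorem flat_six_weights_three : ∀ s, 3 ≤ s → s ≤ 6 →
    Nat.factorial 3 * 2 ^ s ≤ (fun j : ℕ => if j = 0 then 1 else if j = 1 then 2 else if j = 2 then 4 else if j = 3 then 8 else if j = 4 then 32 else if j = 5 then 99 else 387624) 3 * ∏ i ∈ Finset.range 3, max (s - (fun j : ℕ => if j ≤ 2 then 2 ^ j - 1 else if j = 3 then 6 else if j = 4 then 10 else if j = 5 then 19 else 39) i) 1 := by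
  intro s h1 h2
  interval_cases s <;> decide

/-- The finite check at `j ≤ 2`. -/
theorem flat_six_weights_low : ∀ j ≤ 2, ∀ s, j ≤ s → s ≤ (fun j : ℕ => if j ≤ 2 then 2 ^ j - 1 else if j = 3 then 6 else if j = 4 then 10 else if j = 5 then 19 else 39) j →
    j.factorial * 2 ^ s ≤ (fun j : ℕ => if j = 0 then 1 else if j = 1 then 2 else if j = 2 then 4 else if j = 3 then 8 else if j = 4 then 32 else if j = 5 then 99 else 387624) j * ∏ i ∈ Finset.range j, max (s - (fun j : ℕ => if j ≤ 2 then 2 ^ j - 1 else if j = 3 then 6 else if j = 4 then 10 else if j = 5 then 19 else 39) i) 1 := by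
  intro j hj s hjs hs
  have hs' : s ≤ 3 := le_trans hs (by interval_cases j <;> decide)
  interval_cases j <;> interval_cases s <;> first | decide | (exfalso; revert hs; decide)

/-- **THE FINITE CHECK**: `j!·2^s ≤ g_j · ∏_{i<j} max(s − f_i, 1)` for every `j ≤ 6` and `j ≤ s ≤ f_j`. -/
theorem flat_six_weights : ∀ j ≤ 6, ∀ s, j ≤ s → s ≤ (fun j : ℕ => if j ≤ 2 then 2 ^ j - 1 else if j = 3 then 6 else if j = 4 then 10 else if j = 5 then 19 else 39) j →
    j.factorial * 2 ^ s ≤ (fun j : ℕ => if j = 0 then 1 else if j = 1 then 2 else if j = 2 then 4 else if j = 3 then 8 else if j = 4 then 32 else if j = 5 then 99 else 387624) j * ∏ i ∈ Finset.range j, max (s - (fun j : ℕ => if j ≤ 2 then 2 ^ j - 1 else if j = 3 then 6 else if j = 4 then 10 else if j = 5 then 19 else 39) i) 1 := by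
  intro j hj s hjs hs
  rcases Nat.lt_or_ge j 3 with h3 | h3
  · exact flat_six_weights_low j (by omega) s hjs hs
  · interval_cases j
    · exact flat_six_weights_three s hjs (by simpa using hs)
    · exact flat_six_weights_four s hjs (by simpa using hs)
    · exact flat_six_weights_five s hjs (by simpa using hs)
    · exact flat_six_weights_six s hjs (by simpa using hs)

/-- **THE RANK-`≤ 6` COUNT OF AN `e`-FREE MATROID, FLAT BY FLAT**:
`#{ρ ≤ 6} ≤ Σ_{j ≤ 6} C(n, j)·g_j` with `g = 1, 2, 4, 8, 32, 99, 387624`. -/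
theorem ncard_eRk_le_six_le_of_free_flats (M : Matroid α) [M.Finite]
    (hfree : ∀ e ∈ M.E, ∃ A ⊆ M.E \ {e}, e ∉ M.closure A ∧ e ∉ M.closure ((M.E \ {e}) \ A)) :
    {X : Set α | X ⊆ M.E ∧ M.eRk X ≤ ((6 : ℕ) : ℕ∞)}.ncard ≤
      ∑ j ∈ Finset.range (6 + 1), M.E.ncard.choose j * (fun j : ℕ => if j = 0 then 1 else if j = 1 then 2 else if j = 2 then 4 else if j = 3 then 8 else if j = 4 then 32 else if j = 5 then 99 else 387624) j :=
  ncard_eRk_le_le_sum_choose_flats M 6 (fun j : ℕ => if j ≤ 2 then 2 ^ j - 1 else if j = 3 then 6 else if j = 4 then 10 else if j = 5 then 19 else 39) (fun j : ℕ => if j = 0 then 1 else if j = 1 then 2 else if j = 2 then 4 else if j = 3 then 8 else if j = 4 then 32 else if j = 5 then 99 else 387624) (flat_six_of_free' M hfree) flat_six_weights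

/-- **The row `p = 9` at level `6` from `n = 102` on** (`d ≥ 93`; `HyperplaneKeySix`: from `n = 136`, `d ≥ 127`). -/
theorem c025_core_six_hyperplane_key_sharp_nine (M : Matroid α) [M.Finite] (hR : M.eRank = ((9 : ℕ) : ℕ∞))
    (hn : 102 ≤ M.E.ncard)
    (hfree : ∀ e ∈ M.E, ∃ A ⊆ M.E \ {e}, e ∉ M.closure A ∧ e ∉ M.closure ((M.E \ {e}) \ A)) :
    ThmN.RLS M 9 6 :=
  rls_of_hyperplane_key_two_base_weighted M 9 6 hR hfree (fun j : ℕ => if j = 0 then 1 else if j = 1 then 2 else if j = 2 then 4 else if j = 3 then 8 else if j = 4 then 32 else if j = 5 then 99 else 387624) (ncard_eRk_le_six_le_of_free_flats M hfree)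
    102 (by norm_num) hn
    (by rw [phiK_nine_six]; norm_num [Finset.sum_range_succ, Nat.choose])
    (by rw [phiK_nine_six]; norm_num [Finset.sum_range_succ, Nat.choose])

/-- **The row `p = 10` at level `6` from `n = 104` on** (`d ≥ 94`; `HyperplaneKeySix`: from `n = 138`, `d ≥ 128`). -/
theorem c025_core_six_hyperplane_key_sharp_ten (M : Matroid α) [M.Finite] (hR : M.eRank = ((10 : ℕ) : ℕ∞))
    (hn : 104 ≤ M.E.ncard)
    (hfree : ∀ e ∈ M.E, ∃ A ⊆ M.E \ {e}, e ∉ M.closure A ∧ e ∉ M.closure ((M.E \ {e}) \ A)) :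
    ThmN.RLS M 10 6 :=
  rls_of_hyperplane_key_two_base_weighted M 10 6 hR hfree (fun j : ℕ => if j = 0 then 1 else if j = 1 then 2 else if j = 2 then 4 else if j = 3 then 8 else if j = 4 then 32 else if j = 5 then 99 else 387624) (ncard_eRk_le_six_le_of_free_flats M hfree)
    104 (by norm_num) hn
    (by rw [phiK_ten_six]; norm_num [Finset.sum_range_succ, Nat.choose])
    (by rw [phiK_ten_six]; norm_num [Finset.sum_range_succ, Nat.choose])

/-- **The row `p = 11` at level `6` from `n = 106` on** (`d ≥ 95`; `HyperplaneKeySix`: from `n = 140`, `d ≥ 129`). -/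
theorem c025_core_six_hyperplane_key_sharp_eleven (M : Matroid α) [M.Finite] (hR : M.eRank = ((11 : ℕ) : ℕ∞))
    (hn : 106 ≤ M.E.ncard)
    (hfree : ∀ e ∈ M.E, ∃ A ⊆ M.E \ {e}, e ∉ M.closure A ∧ e ∉ M.closure ((M.E \ {e}) \ A)) :
    ThmN.RLS M 11 6 :=
  rls_of_hyperplane_key_two_base_weighted M 11 6 hR hfree (fun j : ℕ => if j = 0 then 1 else if j = 1 then 2 else if j = 2 then 4 else if j = 3 then 8 else if j = 4 then 32 else if j = 5 then 99 else 387624) (ncard_eRk_le_six_le_of_free_flats M hfree)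
    106 (by norm_num) hn
    (by rw [phiK_eleven_six]; norm_num [Finset.sum_range_succ, Nat.choose])
    (by rw [phiK_eleven_six]; norm_num [Finset.sum_range_succ, Nat.choose])

/-- **The row `p = 12` at level `6` from `n = 106` on** (`d ≥ 94`; `HyperplaneKeySix`: from `n = 140`, `d ≥ 128`). -/
theorem c025_core_six_hyperplane_key_sharp_twelve (M : Matroid α) [M.Finite] (hR : M.eRank = ((12 : ℕ) : ℕ∞))
    (hn : 106 ≤ M.E.ncard)
    (hfree : ∀ e ∈ M.E, ∃ A ⊆ M.E \ {e}, e ∉ M.closure A ∧ e ∉ M.closure ((M.E \ {e}) \ A)) :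
    ThmN.RLS M 12 6 :=
  rls_of_hyperplane_key_two_base_weighted M 12 6 hR hfree (fun j : ℕ => if j = 0 then 1 else if j = 1 then 2 else if j = 2 then 4 else if j = 3 then 8 else if j = 4 then 32 else if j = 5 then 99 else 387624) (ncard_eRk_le_six_le_of_free_flats M hfree)
    106 (by norm_num) hn
    (by rw [phiK_twelve_six]; norm_num [Finset.sum_range_succ, Nat.choose])
    (by rw [phiK_twelve_six]; norm_num [Finset.sum_range_succ, Nat.choose])

/-- **The row `p = 13` at level `6` from `n = 108` on** (`d ≥ 95`; `HyperplaneKeySix`: from `n = 142`, `d ≥ 129`). -/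
theorem c025_core_six_hyperplane_key_sharp_thirteen (M : Matroid α) [M.Finite] (hR : M.eRank = ((13 : ℕ) : ℕ∞))
    (hn : 108 ≤ M.E.ncard)
    (hfree : ∀ e ∈ M.E, ∃ A ⊆ M.E \ {e}, e ∉ M.closure A ∧ e ∉ M.closure ((M.E \ {e}) \ A)) :
    ThmN.RLS M 13 6 :=
  rls_of_hyperplane_key_two_base_weighted M 13 6 hR hfree (fun j : ℕ => if j = 0 then 1 else if j = 1 then 2 else if j = 2 then 4 else if j = 3 then 8 else if j = 4 then 32 else if j = 5 then 99 else 387624) (ncard_eRk_le_six_le_of_free_flats M hfree)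
    108 (by norm_num) hn
    (by rw [phiK_thirteen_six]; norm_num [Finset.sum_range_succ, Nat.choose])
    (by rw [phiK_thirteen_six]; norm_num [Finset.sum_range_succ, Nat.choose])

/-- **The row `p = 14` at level `6` from `n = 110` on** (`d ≥ 96`; `HyperplaneKeySix`: from `n = 142`, `d ≥ 128`). -/
theorem c025_core_six_hyperplane_key_sharp_fourteen (M : Matroid α) [M.Finite] (hR : M.eRank = ((14 : ℕ) : ℕ∞))
    (hn : 110 ≤ M.E.ncard)
    (hfree : ∀ e ∈ M.E, ∃ A ⊆ M.E \ {e}, e ∉ M.closure A ∧ e ∉ M.closure ((M.E \ {e}) \ A)) :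
    ThmN.RLS M 14 6 :=
  rls_of_hyperplane_key_two_base_weighted M 14 6 hR hfree (fun j : ℕ => if j = 0 then 1 else if j = 1 then 2 else if j = 2 then 4 else if j = 3 then 8 else if j = 4 then 32 else if j = 5 then 99 else 387624) (ncard_eRk_le_six_le_of_free_flats M hfree)
    110 (by norm_num) hn
    (by rw [phiK_fourteen_six]; norm_num [Finset.sum_range_succ, Nat.choose])
    (by rw [phiK_fourteen_six]; norm_num [Finset.sum_range_succ, Nat.choose])

/-- **The row `p = 15` at level `6` from `n = 110` on** (`d ≥ 95`; `HyperplaneKeySix`: from `n = 144`, `d ≥ 129`). -/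
theorem c025_core_six_hyperplane_key_sharp_fifteen (M : Matroid α) [M.Finite] (hR : M.eRank = ((15 : ℕ) : ℕ∞))
    (hn : 110 ≤ M.E.ncard)
    (hfree : ∀ e ∈ M.E, ∃ A ⊆ M.E \ {e}, e ∉ M.closure A ∧ e ∉ M.closure ((M.E \ {e}) \ A)) :
    ThmN.RLS M 15 6 :=
  rls_of_hyperplane_key_two_base_weighted M 15 6 hR hfree (fun j : ℕ => if j = 0 then 1 else if j = 1 then 2 else if j = 2 then 4 else if j = 3 then 8 else if j = 4 then 32 else if j = 5 then 99 else 387624) (ncard_eRk_le_six_le_of_free_flats M hfree)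
    110 (by norm_num) hn
    (by rw [phiK_fifteen_six]; norm_num [Finset.sum_range_succ, Nat.choose])
    (by rw [phiK_fifteen_six]; norm_num [Finset.sum_range_succ, Nat.choose])

/-- **The row `p = 16` at level `6` from `n = 112` on** (`d ≥ 96`; `HyperplaneKeySix`: from `n = 146`, `d ≥ 130`). -/
theorem c025_core_six_hyperplane_key_sharp_sixteen (M : Matroid α) [M.Finite] (hR : M.eRank = ((16 : ℕ) : ℕ∞))
    (hn : 112 ≤ M.E.ncard)
    (hfree : ∀ e ∈ M.E, ∃ A ⊆ M.E \ {e}, e ∉ M.closure A ∧ e ∉ M.closure ((M.E \ {e}) \ A)) :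
    ThmN.RLS M 16 6 :=
  rls_of_hyperplane_key_two_base_weighted M 16 6 hR hfree (fun j : ℕ => if j = 0 then 1 else if j = 1 then 2 else if j = 2 then 4 else if j = 3 then 8 else if j = 4 then 32 else if j = 5 then 99 else 387624) (ncard_eRk_le_six_le_of_free_flats M hfree)
    112 (by norm_num) hn
    (by rw [phiK_sixteen_six]; norm_num [Finset.sum_range_succ, Nat.choose])
    (by rw [phiK_sixteen_six]; norm_num [Finset.sum_range_succ, Nat.choose])

/-- **The row `p = 17` at level `6` from `n = 114` on** (`d ≥ 97`; `HyperplaneKeySix`: from `n = 146`, `d ≥ 129`). -/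
theorem c025_core_six_hyperplane_key_sharp_seventeen (M : Matroid α) [M.Finite] (hR : M.eRank = ((17 : ℕ) : ℕ∞))
    (hn : 114 ≤ M.E.ncard)
    (hfree : ∀ e ∈ M.E, ∃ A ⊆ M.E \ {e}, e ∉ M.closure A ∧ e ∉ M.closure ((M.E \ {e}) \ A)) :
    ThmN.RLS M 17 6 :=
  rls_of_hyperplane_key_two_base_weighted M 17 6 hR hfree (fun j : ℕ => if j = 0 then 1 else if j = 1 then 2 else if j = 2 then 4 else if j = 3 then 8 else if j = 4 then 32 else if j = 5 then 99 else 387624) (ncard_eRk_le_six_le_of_free_flats M hfree)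
    114 (by norm_num) hn
    (by rw [phiK_seventeen_six]; norm_num [Finset.sum_range_succ, Nat.choose])
    (by rw [phiK_seventeen_six]; norm_num [Finset.sum_range_succ, Nat.choose])

/-- **The row `p = 18` at level `6` from `n = 114` on** (`d ≥ 96`; `HyperplaneKeySix`: from `n = 148`, `d ≥ 130`). -/
theorem c025_core_six_hyperplane_key_sharp_eighteen (M : Matroid α) [M.Finite] (hR : M.eRank = ((18 : ℕ) : ℕ∞))
    (hn : 114 ≤ M.E.ncard)
    (hfree : ∀ e ∈ M.E, ∃ A ⊆ M.E \ {e}, e ∉ M.closure A ∧ e ∉ M.closure ((M.E \ {e}) \ A)) :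
    ThmN.RLS M 18 6 :=
  rls_of_hyperplane_key_two_base_weighted M 18 6 hR hfree (fun j : ℕ => if j = 0 then 1 else if j = 1 then 2 else if j = 2 then 4 else if j = 3 then 8 else if j = 4 then 32 else if j = 5 then 99 else 387624) (ncard_eRk_le_six_le_of_free_flats M hfree)
    114 (by norm_num) hn
    (by rw [phiK_eighteen_six]; norm_num [Finset.sum_range_succ, Nat.choose])
    (by rw [phiK_eighteen_six]; norm_num [Finset.sum_range_succ, Nat.choose])

/-- **The row `p = 19` at level `6` from `n = 116` on** (`d ≥ 97`; `HyperplaneKeySix`: from `n = 150`, `d ≥ 131`). -/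
theorem c025_core_six_hyperplane_key_sharp_nineteen (M : Matroid α) [M.Finite] (hR : M.eRank = ((19 : ℕ) : ℕ∞))
    (hn : 116 ≤ M.E.ncard)
    (hfree : ∀ e ∈ M.E, ∃ A ⊆ M.E \ {e}, e ∉ M.closure A ∧ e ∉ M.closure ((M.E \ {e}) \ A)) :
    ThmN.RLS M 19 6 :=
  rls_of_hyperplane_key_two_base_weighted M 19 6 hR hfree (fun j : ℕ => if j = 0 then 1 else if j = 1 then 2 else if j = 2 then 4 else if j = 3 then 8 else if j = 4 then 32 else if j = 5 then 99 else 387624) (ncard_eRk_le_six_le_of_free_flats M hfree)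
    116 (by norm_num) hn
    (by rw [phiK_nineteen_six]; norm_num [Finset.sum_range_succ, Nat.choose])
    (by rw [phiK_nineteen_six]; norm_num [Finset.sum_range_succ, Nat.choose])

/-- **The row `p = 20` at level `6` from `n = 118` on** (`d ≥ 98`; `HyperplaneKeySix`: from `n = 150`, `d ≥ 130`). -/
theorem c025_core_six_hyperplane_key_sharp_twenty (M : Matroid α) [M.Finite] (hR : M.eRank = ((20 : ℕ) : ℕ∞))
    (hn : 118 ≤ M.E.ncard)
    (hfree : ∀ e ∈ M.E, ∃ A ⊆ M.E \ {e}, e ∉ M.closure A ∧ e ∉ M.closure ((M.E \ {e}) \ A)) :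
    ThmN.RLS M 20 6 :=
  rls_of_hyperplane_key_two_base_weighted M 20 6 hR hfree (fun j : ℕ => if j = 0 then 1 else if j = 1 then 2 else if j = 2 then 4 else if j = 3 then 8 else if j = 4 then 32 else if j = 5 then 99 else 387624) (ncard_eRk_le_six_le_of_free_flats M hfree)
    118 (by norm_num) hn
    (by rw [phiK_twenty_six]; norm_num [Finset.sum_range_succ, Nat.choose])
    (by rw [phiK_twenty_six]; norm_num [Finset.sum_range_succ, Nat.choose])

/-- **The row `p = 21` at level `6` from `n = 120` on** (`d ≥ 99`; `HyperplaneKeySix`: from `n = 152`, `d ≥ 131`). -/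
theorem c025_core_six_hyperplane_key_sharp_twentyone (M : Matroid α) [M.Finite] (hR : M.eRank = ((21 : ℕ) : ℕ∞))
    (hn : 120 ≤ M.E.ncard)
    (hfree : ∀ e ∈ M.E, ∃ A ⊆ M.E \ {e}, e ∉ M.closure A ∧ e ∉ M.closure ((M.E \ {e}) \ A)) :
    ThmN.RLS M 21 6 :=
  rls_of_hyperplane_key_two_base_weighted M 21 6 hR hfree (fun j : ℕ => if j = 0 then 1 else if j = 1 then 2 else if j = 2 then 4 else if j = 3 then 8 else if j = 4 then 32 else if j = 5 then 99 else 387624) (ncard_eRk_le_six_le_of_free_flats M hfree)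
    120 (by norm_num) hn
    (by rw [phiK_twentyone_six]; norm_num [Finset.sum_range_succ, Nat.choose])
    (by rw [phiK_twentyone_six]; norm_num [Finset.sum_range_succ, Nat.choose])

end HypKey

end PercRepro
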